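import Mathlib
import Summits.Langlands.Langlands.Theses.PicardMuOrdinary
import Literature.NumberTheory.GaloisRepresentations.CubicResidueSymbol
import Literature.NumberTheory.GaloisRepresentations.GaloisRep
import Literature.NumberTheory.Automorphic.ReciprocityGLnProofs
import Literature.NumberTheory.Automorphic.AsaiSign
import Summits.Langlands.Langlands.Theorems.PicardMuOrdinaryIrregularClassicalityPlaceOfMaximalIdeal

/-!
# Line `split-ramified-prime-sqrt6` — checked skeleton for the crux
`Summit.Langlands.Langlands.Theses.PicardMuOrdinary.IrregularClassicality` (stmt-Langlands-13758)

Planner crux-plan (round 1), idea card `Cruxes/IrregularClassicality/Ideas/split-ramified-prime-sqrt6.md`,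
triage `TRIAGE-r1-{1,2,3}.md` (pass ×3).  Seven registered stubs `stub_*` (sorried; each a genuine
lemma of the line) and the kernel-checked composition
`IrregularClassicality_of : IrregularClassicality` (pure logic; the only `sorry`s are inside the
stubs).  See `Lines/split-ramified-prime-sqrt6.md` for the line card.

Notation in comments: `K = ℚ(ω) = CyclotomicField 3 ℚ`, `λ = (1 - ω)` its prime above `3`,
`ℤ̄ = integralClosure ℤ ℂ`, `ℚ̄₃ = PadicAlgCl 3`, `a_𝔭(f) = picardTrace f 𝔭`, `ϖ_𝔭 ∈ 𝓞_K` the PRIMARY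
generator of a prime `𝔭 ∤ 3` (`𝔭 = (ϖ_𝔭)`, `ϖ_𝔭 ≡ 1 mod 3`; unique: `𝓞_K` is a PID and its six units are
distinct modulo `3 = -ω²λ²`), `ψ` the algebraic Hecke character of `K` of conductor `(3)` and
infinity type `(1,0)` with `ψ((α)) = α` for `α ≡ 1 mod 3` (so `ψ(𝔭) = ϖ_𝔭`, `ψ ψ^c = N`),
`ρ_C = V_e : Γ_K → GL₃(ℚ̄₃)` the `λ`-adic representation of the Picard curve `C : y³ = f(x)` read
through `(ι, e)` (geometric Frobenius trace `ι⁻¹ e(a_𝔭 f)`), and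
`ρ'_C = ρ_C ⊗ ψ` its CM TWIST (geometric Frobenius trace `ι⁻¹ e(a_𝔭(f)·ϖ_𝔭)`).
`L = K(√-2) = ℚ(√-3, √-2) = K(√6)` (since `√6·√-3 = 3√-2`), `L⁺ = ℚ(√6)`, `c ∈ Gal(L/ℚ)` the
involution with fixed field `L⁺` (it restricts to complex conjugation `c₀` of `K` and sends
`√-2 ↦ -√-2`), `u, ū` the two primes of `L` above `λ` (`L_u = K_λ = ℚ₃(√-3) = ℚ₃(√6)`: `-2 ≡ 1 mod 3`
is a `3`-adic square), `G' = U(2,1)_{L/L⁺}`, whose Shimura variety is a unitary FOURFOLD with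
`G'(ℚ₃) = GL₃(K_λ)`.

WHY THE TWIST (planner's parity check, NOTES.md §Parity): `ρ_C` is polarized with an ODD
multiplier, `ρ_C^{c₀} ≅ ρ_C^∨ ⊗ ε^{-1}` (Weil pairing + `ℤ[ω]`-action; `det ρ_C · (det ρ_C)^{c₀} = ε^{-3}`,
motivic weight `1`, rank `3`), whereas the Galois representation of a regular algebraic cuspidal `Π`
on `GL₃(𝔸_K)` with `Π^{c₀} ≅ Π^∨` EXACTLY (the tree's `IsConjSelfDualAE c₀`) has the EVEN multiplier
`ε^{-2}` (`det r · (det r)^{c₀} = ε^{-6}`).  Since `ε³ ≢ 1 mod 27` on `Γ_K`, no such `Π` can have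
`N𝔭·ΣSat(Π,𝔭) ≡ e(a_𝔭 f)` modulo `3^k ℤ̄_𝔐` for `k ≥ 4`: an exactly polarized tower must approximate the
TWIST `ρ'_C = ρ_C ⊗ ψ` (multiplier `ε^{-2}`, weights `{1,1,2} | {0,1,1}` — the object that actually
lives on the unitary Shimura varieties), i.e. the traces `a_𝔭(f)·ϖ_𝔭`.  The polarized towers below
are therefore `ψ`-TWISTED, and the untwist `π'_K ↦ π'_K ⊗ ψ^{-1}` is part of the descent stub.  (The
restate "add `IsConjSelfDualAE` to the `P_k` of 13757/13758" requested by the triage would, taken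
literally, make 13757's conclusion unsatisfiable — see the line card, Triage answers.)

THE LEVER (card): the one-line field change `K ↦ L` converts the crux's local type at `3` from the
ramified unitary (AR) case (reducible Pappas–Rapoport fibre, μ-ordinary locus not dense, anisotropic
degree-1 cell) to the SPLIT case (smooth μ-ordinary-dense splitting model, Borel/two-`U`-operator
Hida theory, both degree-1 Cousin targets `(1,0′), (0,1′)` meeting the μ-ordinary locus — the
incident-pair census checked by all three triagers), WITHOUT changing the local Galois
representation (`L_u = K_λ`).  There the ordinary irregular-weight classicality of BCGP 2025
(higher Hida in degrees `0,1`, `p`-adic Eichler–Shimura, Sen = Cousin) is run with TWO walls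
(weight `((1,1,1),(1,1,1))`, one μ-ordinary projector, two Sen operators) — BCGP's announced open
extension "`p` arbitrary in the totally real field" with `e = 2` (arXiv:2502.20645 p. 3) — and the
irregular automorphy is DESCENDED `L → K` by Arthur–Clozel for `GL₃` (weight-blind) plus a
Goldring–Koskivirta sign check at the primes inert in `L/K`, and untwisted by `ψ^{-1}`.

Shape of the line (Galois currency between stubs, as in the sibling line
`Cruxes/MuOrdinaryFamilyRT/Lines/weight-blind-lambda-adic-rt.lean`, whose `F' = K(√6)` IS our `L`):
* `stub_placeOfMaximalIdeal` — every maximal `𝔐 ∋ 3` of `ℤ̄ ⊂ ℂ` is the place of an isomorphism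
  `ι : ℚ̄₃ ≃ ℂ`: `v_𝔐(z) ≥ k ⇒ ‖ι⁻¹ z‖ ≤ 3^{-k}` (Steinitz + conjugacy of extensions of `|·|₃` to
  `ℚ̄`; pure algebra, provable now; the converse dictionary of the sibling's `stub_dictionary`).
* `stub_twistedPicardGaloisInput` — the primary generators `ϖ` off a finite `S₀ ⊇ {v ∣ 3}` and the
  twisted Picard representation `ρ'_C` through `(ι, e)`: unramified outside `S₀`, geometric Frobenius
  trace `ι⁻¹ e(a_𝔭(f)·ϖ_𝔭)`, absolutely irreducible on `Γ_L` for EVERY quadratic `L/K` (`A₄` has no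
  subgroup of index `2`).  The sibling's Stub A, twisted by the CM character.
* `stub_polarizedTwistedTower` — THE INTERFACE DEBT (Disproof item 7/17(a), triage F1 ×3), in its
  CORRECT (twisted) form: from the typed tower for `a_𝔭(f)`, an exactly conjugate-self-dual
  (`IsConjSelfDualAE c₀`) regular cuspidal tower for `a_𝔭(f)·ϖ_𝔭`.  NOT to be staffed: it is what
  every intended tower of 13757 is before untwisting, and it is discharged by restating the
  13757 → 13758 interface in this twisted-polarized normal form; before that it is a polarized
  `R = T`-sized statement (13757-hard).
* `stub_baseChangeToL` — Arthur–Clozel base change of a polarized tower to `L = K(√-2)`, in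
  GALOIS-CONVERGENT form (general target function `a`, general `ρ`): constructs
  `(L, s = √-2, c, hcptL, S_L)` and, for every `k`, a regular algebraic conjugate-self-dual cuspidal
  `Π_k` on `GL₃(𝔸_L)` unramified outside `S_L` with its HLTT representation `r_k` (lang.S27) and
  `‖tr r_k − tr ρ|_{Γ_L}‖ ≤ 3^{-k}` on `Γ_L` (Chebotarev density of degree-one Frobenii + continuity +
  the place dictionary).  Known-results assembly.
* `stub_twoWallOrdinaryClassicality` — THE HEART (card K1 + K2 + K3(a); hardest): for μ-ordinary
  generic `f`, `ρ'_C|_{Γ_L}` a limit of polarized regular cuspidal `Π_k` ⇒ `ρ'_C|_{Γ_L}` is automorphic: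
  cuspidal L-algebraic `π'_L` on `GL₃(𝔸_L)` with full Frobenius compatibility a.e.
  (`arithFrobPolyOfSatake ι q 1 β`).  Inside: (i) μ-ordinary REALIZATION of `λ'_{C,L}` in the
  μ-ordinary higher-Hida `H⁰` of weight `((1,1,1),(1,1,1))` (up to the twist) of the fourfold (needs an
  ORDINARY AVATAR of the slope-free typed tower — second half of the interface debt — and typicity
  via BCGP Lemma 276, triage F3); (ii) TWO-WALL ORDINARY SEN = COUSIN for `Res_{K_λ/ℚ₃} GL₃`,
  `μ = ((1,0,0),(1,1,0))`, one μ-ordinary projector, Sen components `Θ_{σ₁}, Θ_{σ₂}`, Cousin maps into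
  the incident cells `(1,0′), (0,1′)` (triage-2 sharpening; load-bearing, BCGP's open extension);
  (iii) multiplicity one (K3(a)); (iv) transfer `G' → GL₃/L` (Rogawski/Mok) of the classical form,
  whose eigensystem gives the Frobenius compatibility at split AND inert places.
* `stub_irregularDescentUntwist` — weight-blind cyclic descent `L → K` of the irregular `π'_L`
  (Arthur–Clozel Thm. III.4.2 (d); Satake multisets Galois-stable by the compatibility with
  `ρ'_C|_{Γ_L}`), the twist/sign ambiguity at primes inert in `L/K` pinned by the Goldring–Koskivirta
  pseudo-representation of the descended limit-of-discrete-series form on `GU(2,1)_{K/ℚ}` compared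
  with `ρ'_C` over `L` (Chebotarev + Brauer–Nesbitt + Clifford), then the untwist by the automorphic
  CM character `ψ^{-1}`: output in the crux's SUM form `Σ Satake(π_K, 𝔭) = e(a_𝔭 f)` a.e.
* RESHAPE r2 (lead prover-line-stmt-Langlands-13758-0, 2026-08-16, after the parallel drefute
  seats' findings `DrefuteVacuity-…`, `DrefuteNote-stub-{polarizedTwistedTower,
  twoWallOrdinaryClassicality,nonMuOrdinaryRemainder}.md`, `DrefuteG2-RepairCheck-…` in this
  directory): the planner's case split on `HasMuOrdinaryReductionAtThree f` (definition D1: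
  potentially good reduction of the CURVE with `3`-rank `2`) is EMPTY on `ℤ[X]` — Börner–Bouw–Wewers
  2017 (arXiv:1701.01986 §3.2, Lemma 4 with Lemma 3): over an absolutely unramified `3`-adic field a
  Picard curve with potentially good reduction reduces to the ONE-branch-point curve `y³ − y = x⁴`,
  of `3`-rank `0`.  So Stubs 3 and 5 were vacuous and the former Stub 7 (the negated predicate
  implies the crux) WAS the crux verbatim (a costume).  The split is therefore REMOVED: Stubs 3 and
  5 are now stated for every generic `f`, Stub 7 is deleted, and `IrregularClassicality_of` is the
  linear chain 1 → 2 → 3 → 4 → 5 → 6.  The honest re-split of Stub 5 into "μ-ordinary-JACOBIAN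
  engine" + "conceded remainder" needs the repaired predicate
  `HasMuOrdinaryJacobianReductionAtThree f` (J(C_f) potentially good of `3`-rank `2` = BBW type (b),
  WITHOUT the `Nodup` clause; non-empty: `f_b = 3x⁴ + x³ − 54`, `S₄`, BBW Ex. 2 — drefute g2 §2–3),
  a definition the tree does not have yet (definition request recorded in the lead's NOTES/Census;
  planner's restate).  Until then the remainder (λ-basic Jacobian — which by BBW includes EVERY
  admissible `f` whose CURVE has potentially good reduction, e.g. the CM anchor `f₆₇` — and the
  potentially multiplicative types (c)–(e)) lives inside Stub 5's domain, where no ordinary engine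
  applies; Stub 5 is TRUE there all the same (it is implied by reciprocity, Disproof item 2).

Disproof.lean (cycles 1–2) honoured: no `_false_without_` theorem exists (item 2); the tower is
USED (items 5/9/13: `stub_baseChangeToL` consumes every depth `k`, nothing stationary or of finite
eigensystem range is assumed); item 11/§7 (embedding may be fixed) is not even needed — the stubs
are uniform in `e`; item 12/§6 (`S` enlarged freely: `S ∪ S₀ ⊆ S'`, `S_L ⊇` places above `S₀` and
`3`, `S₀ ⊇ {v ∣ 3}`); item 4 (normalisations: `N𝔭·Σα` for the regular `P_k`/`Π_k` via
`IsGaloisCompatibleAt` (`m = n = 3`), `Σα` with `m = 1` for the L-algebraic `π'_L`, `π_K`); item 6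
(`u ∉ 𝔐 ∧ u t ∈ (3^k)` = `v_𝔐(t) ≥ k`, exactly the hypothesis shape of `stub_placeOfMaximalIdeal`);
item 7/17(a) isolated — and corrected by the twist — as `stub_polarizedTwistedTower`.  No stub is an
instance of a landed Negative lemma (`Negative/StationaryCollapse`, `EmbeddingWLOG`,
`FiniteRangeCollapse` are positive partial results).
-/

open Literature.NumberTheory.GaloisRepresentations Literature.NumberTheory.Automorphic
open IsDedekindDomain NumberField Polynomial

set_option linter.dupNamespace false

namespace Summit.Langlands.Langlands.Cruxes.IrregularClassicality.SplitRamifiedPrimeSqrt6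

/-! ## The six stubs (reshape r2: the vacuous μ-ordinary case split and its remainder stub are removed) -/

/-! **Stub 1 — `stub_placeOfMaximalIdeal` — LANDED** (p78785,
`Summits/Langlands/Langlands/Theorems/PicardMuOrdinaryIrregularClassicalityPlaceOfMaximalIdeal.lean`,
decl `Summit.Langlands.Langlands.Theorems.IrregularClassicality.SplitRamifiedPrimeSqrt6.stub_placeOfMaximalIdeal`,
unconditional, axioms standard): every maximal `𝔐 ∋ 3` of `ℤ̄ ⊂ ℂ` is the place of an isomorphism
`ι : ℚ̄₃ ≃+* ℂ` with `(∃ u ∉ 𝔐, u z ∈ (3^k)) → ‖ι⁻¹ z‖ ≤ 3^{-k}`.  Imported above and used below by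
its fully qualified name; reusable helpers in the same file: `padicAlgCl_norm_le_one_of_isIntegral`,
`exists_smul_eq_of_under_eq_of_isGalois` (Gal transitive on primes of `𝓞 K` over a prime of `ℤ`,
`K/ℚ` possibly infinite Galois), `exists_ringEquiv_complex_mem_iff_of_under_eq` (Aut ℂ transitive on
primes of `ℤ̄` over `p`). -/

/-- **Stub 2 — the Galois input: primary generators and the CM-twisted Picard representation
`ρ'_C = ρ_C ⊗ ψ` through a given `(ι, e)`.**  For a separable quartic `f ∈ ℤ[X]` with `12 ∣ #Gal(f)`
and ANY `ι : ℚ̄₃ ≃+* ℂ`, `e : K →+* ℂ`: there are a finite set `S₀` of finite places of `K = ℚ(ω)`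
containing every place above `3`, a choice of PRIMARY GENERATORS off `S₀` (`𝔭 = (ϖ_𝔭)`,
`ϖ_𝔭 ≡ 1 mod 3`; `𝓞_K` is a PID — Mathlib — and its units `±ω^i` are distinct mod `3`, so `ϖ_𝔭` is
unique), and a continuous `ρ : Γ_K → GL₃(ℚ̄₃)` (intended: `V_e ⊗ ψ_{ι,e}`, where `V_e` is the
eigen-summand of `T₃ J(C) ⊗ ℚ̄₃` on which `ω ∈ ℤ[ω] ⊆ End J(C)` acts by `ι⁻¹(e(ω))`, `C : y³ = f(x)`,
and `ψ_{ι,e}` is the continuous character of `Γ_K` attached through `ι⁻¹ ∘ e` to the algebraic Hecke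
character `ψ` of conductor `(3)`, `ψ((α)) = α` for `α ≡ 1 mod 3`, normalised by
`ψ_{ι,e}(Frob_𝔭⁻¹) = ι⁻¹ e(ϖ_𝔭)` for arithmetic Frobenii `Frob_𝔭`) which is unramified at every
`𝔭 ∉ S₀`, has GEOMETRIC Frobenius trace `ι⁻¹(e(a_𝔭(f) · ϖ_𝔭))` there (twisted Lefschetz on the
eigenpart, Disproof item 16: `tr(F_q^* | H¹[u^* = e(ω)]) = e(a_𝔭(f))` for every embedding `e`;
`a_𝔭(f) = -Σ_x χ_𝔭(f(x))`, `CubicResidueSymbol`; times `ψ`), and whose restriction to `Γ_L` is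
absolutely irreducible for EVERY quadratic extension `L/K`: `ρ̄` restricted to `Γ_K` has image
`⊇ A₄` in the reflection representation on `𝔽₃⁴/diag` (Poonen–Schaefer, Upton), `Γ_L` has index `2`,
`A₄` has no subgroup of index `2`, and the reflection representation of `A₄` is absolutely irreducible
in characteristic `3` (Clifford: `V₄` acts through three distinct characters permuted transitively
by `C₃`); an absolutely irreducible reduction forces absolute irreducibility; a twist changes
nothing.  WHY TWISTED: `ρ = ρ'_C` is polarized with the EVEN multiplier `ε^{-2}`
(`ψ ψ^{c₀} = N ↔ ε^{-1}`, so `(ρ_C ψ)^{c₀} ≅ (ρ_C ψ)^∨ ε^{-2}`), the only parity an exactly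
conjugate-self-dual regular tower can approximate (module docstring).  Size L (Jacobian/Tate module
absent from Mathlib; tree: `SuperellipticTorsionRep`, `CubicResidueSymbol`,
`AbsolutelyIrreducibleReduction`, `HeckeCharacter`/`AlgebraicHeckeCharacterGrossencharakterProofs`
for the CM character; Mathlib `IsCyclotomicExtension.Rat.Three` for units/`λ`). -/
theorem stub_twistedPicardGaloisInput :
    ∀ (f : ℤ[X]), f.natDegree = 4 → (f.map (Int.castRingHom ℚ)).Separable →
      12 ∣ Nat.card (f.map (Int.castRingHom ℚ)).Gal →
    ∀ (ι : PadicAlgCl 3 ≃+* ℂ) (e : CyclotomicField 3 ℚ →+* ℂ),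
    ∃ (S₀ : Finset (HeightOneSpectrum (𝓞 (CyclotomicField 3 ℚ))))
      (ϖ : HeightOneSpectrum (𝓞 (CyclotomicField 3 ℚ)) → 𝓞 (CyclotomicField 3 ℚ))
      (ρ : FramedGaloisRep (CyclotomicField 3 ℚ) (PadicAlgCl 3) 3),
      (∀ v : HeightOneSpectrum (𝓞 (CyclotomicField 3 ℚ)),
        ((3 : ℕ) : 𝓞 (CyclotomicField 3 ℚ)) ∈ v.asIdeal → v ∈ S₀) ∧
      (∀ (L : Type) [Field L] [NumberField L] [Algebra (CyclotomicField 3 ℚ) L],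
        Module.finrank (CyclotomicField 3 ℚ) L = 2 →
          FramedRep.IsAbsolutelyIrreducible (ρ.restrictField L)) ∧
      ∀ 𝔭 ∉ S₀,
        (𝔭.asIdeal = Ideal.span {ϖ 𝔭} ∧
          ϖ 𝔭 - 1 ∈ Ideal.span {(3 : 𝓞 (CyclotomicField 3 ℚ))}) ∧
        ρ.IsUnramifiedAt 𝔭 ∧
        ∀ 𝔓 ∈ 𝔭.primesAbove, ∀ τ : Field.absoluteGaloisGroup (CyclotomicField 3 ℚ),
          IsArithFrobAt (𝓞 (CyclotomicField 3 ℚ)) τ 𝔓 →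
            FramedRep.trace ρ τ⁻¹ = ι.symm (e (↑(picardTrace f 𝔭 * ϖ 𝔭))) := by
  sorry

/-- **Stub 3 — THE INTERFACE DEBT, correctly twisted: the typed tower, polarized** (Disproof items
7, 17(a); triage F1 of all three triagers; first lemma `PolarizeTower` of the card — corrected).
For generic `f` (reshape r2: the vacuous μ-ordinary restriction of round 1 is dropped, see the
module docstring), a typed tower `(e, 𝔐, S, (P_k)_k)` as in the crux hypothesis
(`N𝔭·ΣSat(P_k,𝔭) ≡ e(a_𝔭 f)` modulo `3^k ℤ̄_𝔐` off `S`) and primary generators `ϖ` off `S₀`, there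
are complex conjugation `c₀ ≠ 1` of `K`, a level `S' ⊇ S ∪ S₀`, and for every `k` a regular
algebraic cuspidal `Π_k` on `GL₃(𝔸_K)` which is EXACTLY CONJUGATE SELF-DUAL (`IsConjSelfDualAE c₀`:
`Sat(Π, c₀ 𝔭) = Sat(Π, 𝔭)⁻¹` a.e., i.e. a base change from `U(2,1)_{K/ℚ}` — the only automorphic data
that live on the Picard surface / the fourfold) with `N𝔭·ΣSat(Π_k,𝔭) ≡ e(a_𝔭(f)·ϖ_𝔭)` modulo
`3^k ℤ̄_𝔐` off `S'` — i.e. a polarized tower for the TWIST `ρ'_C = ρ_C ⊗ ψ` (intended: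
`Π_k = P_k ⊗ ψ` for the INTENDED `P_k`, which are untwists of unitary-group family members; an exactly
polarized tower for `a_𝔭(f)` itself cannot exist, module docstring).  STATUS: as typed this does NOT
follow from the unpolarized tower (a `3`-adic automorphic descent `GL₃ → U(3)` for a non-classical
limit point; on paper a polarized `R = T`-type existence statement of 13757's size), but it is
exactly what every intended tower of 13757 delivers (`weight-blind-lambda-adic-rt` over the SAME field
`L`, `free-seed-smooth-rt`, …) and what the typed 13757 → 13758 interface forgets.  RESOLUTION
REQUESTED (not a prover task): the tenure planner restates `MuOrdinaryFamilyRT`'s conclusion and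
`IrregularClassicality`'s hypothesis in this twisted-polarized normal form (members
`IsConjSelfDualAE c₀`, congruent to `e(a_𝔭(f)·ϖ_𝔭)` with `ϖ_𝔭` the primary generator) — NOT the
literal "add `IsConjSelfDualAE` to the `P_k`", which is unsatisfiable for `k ≥ 4`; this stub is then
the identity and the lead drops it.  The same restate should carry an ORDINARITY-AT-`λ` clause
(see Stub 5 (i)).  Registered so that the debt is ONE named obligation instead of a silent
hypothesis of Stubs 4–5.  Size: interface. -/
theorem stub_polarizedTwistedTower :
    ∀ (f : ℤ[X]) (hcpt : isCompact_glFiniteIntegralLevel 3 (CyclotomicField 3 ℚ)),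
      f.natDegree = 4 → (f.map (Int.castRingHom ℚ)).Separable →
      12 ∣ Nat.card (f.map (Int.castRingHom ℚ)).Gal →
    ∀ (e : CyclotomicField 3 ℚ →+* ℂ) (𝔐 : Ideal (integralClosure ℤ ℂ))
      (S S₀ : Finset (HeightOneSpectrum (𝓞 (CyclotomicField 3 ℚ))))
      (ϖ : HeightOneSpectrum (𝓞 (CyclotomicField 3 ℚ)) → 𝓞 (CyclotomicField 3 ℚ)),
      𝔐.IsMaximal → (3 : integralClosure ℤ ℂ) ∈ 𝔐 →
      (∀ 𝔭 ∉ S₀, 𝔭.asIdeal = Ideal.span {ϖ 𝔭} ∧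
        ϖ 𝔭 - 1 ∈ Ideal.span {(3 : 𝓞 (CyclotomicField 3 ℚ))}) →
      (∀ k : ℕ, ∃ P : CuspidalAutomorphicRepData 3 (CyclotomicField 3 ℚ) hcpt,
        P.1.IsRegularAlgebraic ∧
        ∀ 𝔭 ∉ S, ∃ (α : Multiset ℂ) (t u : integralClosure ℤ ℂ), P.1.HasSatakeParamAt 𝔭 α ∧
          (t : ℂ) = (𝔭.residueCard : ℂ) * α.sum - e (picardTrace f 𝔭) ∧ u ∉ 𝔐 ∧
          u * t ∈ Ideal.span {(3 : integralClosure ℤ ℂ) ^ k}) →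
    ∃ (c₀ : CyclotomicField 3 ℚ ≃ₐ[ℚ] CyclotomicField 3 ℚ)
      (S' : Finset (HeightOneSpectrum (𝓞 (CyclotomicField 3 ℚ)))), c₀ ≠ 1 ∧ S ⊆ S' ∧ S₀ ⊆ S' ∧
      ∀ k : ℕ, ∃ P : CuspidalAutomorphicRepData 3 (CyclotomicField 3 ℚ) hcpt,
        P.1.IsRegularAlgebraic ∧ P.1.IsConjSelfDualAE c₀ ∧
        ∀ 𝔭 ∉ S', ∃ (α : Multiset ℂ) (t u : integralClosure ℤ ℂ), P.1.HasSatakeParamAt 𝔭 α ∧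
          (t : ℂ) = (𝔭.residueCard : ℂ) * α.sum - e (↑(picardTrace f 𝔭 * ϖ 𝔭)) ∧ u ∉ 𝔐 ∧
          u * t ∈ Ideal.span {(3 : integralClosure ℤ ℂ) ^ k} := by
  sorry

/-- **Stub 4 — base change of a polarized tower to `L = K(√-2)`, in Galois-convergent form
(Arthur–Clozel + lang.S27 + Chebotarev; known-results assembly).**  Data: a `3`-adic place `𝔐` with
an adapted `ι` (the conclusion of Stub 1 as HYPOTHESIS), complex conjugation `c₀ ≠ 1` of `K`, a
continuous `ρ : Γ_K → GL₃(ℚ̄₃)` unramified outside `S₀ ⊇ {v ∣ 3}` with geometric Frobenius traces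
`ι⁻¹(a 𝔭)` (`a` ANY complex-valued function of the place — the composition takes
`a 𝔭 = e(a_𝔭(f)·ϖ_𝔭)` and `ρ = ρ'_C`), and an exactly polarized regular cuspidal tower `(P_k)` on
`GL₃(𝔸_K)` at level `S` with `N𝔭·ΣSat(P_k,𝔭) ≡ a(𝔭) mod 3^k ℤ̄_𝔐`.  Conclusion: a number field `L`
with `[L : K] = 2` generated by `s`, `s² = -2` (so `L = K(√-2) = ℚ(√-3,√-2)`, CM, biquadratic), an
involution `c ∈ Gal(L/ℚ)` with `c s = -s` restricting to `c₀` on `K` (fixed field `ℚ(√6) = L⁺`), a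
level `S_L` containing the places above `3` and above `S₀`, and for every `k` a regular algebraic,
conjugate self-dual (`IsConjSelfDualAE c`), cuspidal `Π_k` on `GL₃(𝔸_L)` unramified outside `S_L`
together with a continuous `r_k : Γ_L → GL₃(ℚ̄₃)` attached to it at every `w ∉ S_L`
(`IsGaloisCompatibleAt`, lang.S27 shape `m = n = 3`) such that `‖tr r_k(g) - tr ρ(g)‖ ≤ 3^{-k}` for ALL
`g ∈ Γ_L`.  Intended proof: `L := K[X]/(X² + 2)` (`NumberField`, `IsCMField.of_isMulCommutative`),
`c` from the automorphisms `√-2 ↦ -√-2`, `ω ↦ ω²`; `Π_k := BC_{L/K}(P_k)` (lang.S23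
`exists_baseChange_cyclic`; cuspidal by Arthur–Clozel III.4.2 (a) since `P ≅ P ⊗ χ_{L/K}` is
impossible for `n = 3` odd — compare central characters; regular algebraic by
`ArthurClozel1989_strongLifting_archimedean`; conjugate self-dual for `c` because `c|_K = c₀`,
`Sat(BC P, c w) = Sat(P, c₀ 𝔭)^{f}` and `Sat(BC P, w) = Sat(P,𝔭)^{f(w|𝔭)}`); `S_L :=` places above
`S ∪ S₀ ∪ {2, 3}`; `r_k := r_{3,ι}(Π_k)` (lang.S27 `exists_galoisRep_of_regularAlgebraic`, `L` CM);
at a degree-one `w ∉ S_L` over `𝔭`: `tr r_k(Frob_w⁻¹) = ι⁻¹(N w·ΣSat(Π_k,w)) = ι⁻¹(N𝔭·ΣSat(P_k,𝔭))`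
(inverse roots of `arithFrobPolyOfSatake ι q 3 β`; `hasSatakeParamAt_ne_zero`) and
`tr ρ|_{Γ_L}(Frob_w⁻¹) = tr ρ(Frob_𝔭⁻¹) = ι⁻¹(a 𝔭)` (restriction of a degree-one Frobenius along
`absGaloisRestrict K L` is a Frobenius), so the hypothesis `u t ∈ (3^k)`, `u ∉ 𝔐` and the adaptedness
of `ι` give `‖tr r_k - tr ρ_L‖ ≤ 3^{-k}` on these Frobenii; they are dense in `Γ_L` (Chebotarev:
degree-one primes have density one; tree `chebotarev`/`frobenius_dense` facts) and both traces are
continuous class functions, so the closed condition holds on all of `Γ_L`.  Size M/L. -/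
theorem stub_baseChangeToL :
    ∀ (𝔐 : Ideal (integralClosure ℤ ℂ)), 𝔐.IsMaximal → (3 : integralClosure ℤ ℂ) ∈ 𝔐 →
    ∀ (ι : PadicAlgCl 3 ≃+* ℂ),
      (∀ (z : integralClosure ℤ ℂ) (k : ℕ),
        (∃ u : integralClosure ℤ ℂ, u ∉ 𝔐 ∧ u * z ∈ Ideal.span {(3 : integralClosure ℤ ℂ) ^ k}) →
        ‖ι.symm (z : ℂ)‖ ≤ ((3 : ℝ)⁻¹) ^ k) →
    ∀ (hcpt : isCompact_glFiniteIntegralLevel 3 (CyclotomicField 3 ℚ))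
      (c₀ : CyclotomicField 3 ℚ ≃ₐ[ℚ] CyclotomicField 3 ℚ), c₀ ≠ 1 →
    ∀ (S S₀ : Finset (HeightOneSpectrum (𝓞 (CyclotomicField 3 ℚ))))
      (a : HeightOneSpectrum (𝓞 (CyclotomicField 3 ℚ)) → ℂ)
      (ρ : FramedGaloisRep (CyclotomicField 3 ℚ) (PadicAlgCl 3) 3),
      (∀ v : HeightOneSpectrum (𝓞 (CyclotomicField 3 ℚ)),
        ((3 : ℕ) : 𝓞 (CyclotomicField 3 ℚ)) ∈ v.asIdeal → v ∈ S₀) →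
      (∀ 𝔭 ∉ S₀, ρ.IsUnramifiedAt 𝔭 ∧
        ∀ 𝔓 ∈ 𝔭.primesAbove, ∀ τ : Field.absoluteGaloisGroup (CyclotomicField 3 ℚ),
          IsArithFrobAt (𝓞 (CyclotomicField 3 ℚ)) τ 𝔓 → FramedRep.trace ρ τ⁻¹ = ι.symm (a 𝔭)) →
      (∀ k : ℕ, ∃ P : CuspidalAutomorphicRepData 3 (CyclotomicField 3 ℚ) hcpt,
        P.1.IsRegularAlgebraic ∧ P.1.IsConjSelfDualAE c₀ ∧
        ∀ 𝔭 ∉ S, ∃ (α : Multiset ℂ) (t u : integralClosure ℤ ℂ), P.1.HasSatakeParamAt 𝔭 α ∧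
          (t : ℂ) = (𝔭.residueCard : ℂ) * α.sum - a 𝔭 ∧ u ∉ 𝔐 ∧
          u * t ∈ Ideal.span {(3 : integralClosure ℤ ℂ) ^ k}) →
    ∃ (L : Type) (_ : Field L) (_ : NumberField L) (_ : Algebra (CyclotomicField 3 ℚ) L)
      (s : L) (c : L ≃ₐ[ℚ] L) (hcptL : isCompact_glFiniteIntegralLevel 3 L)
      (S_L : Finset (HeightOneSpectrum (𝓞 L))),
      NumberField.IsCMField L ∧ s ^ 2 = -2 ∧ Module.finrank (CyclotomicField 3 ℚ) L = 2 ∧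
      c s = -s ∧
      (∀ x : CyclotomicField 3 ℚ,
        c (algebraMap (CyclotomicField 3 ℚ) L x) = algebraMap (CyclotomicField 3 ℚ) L (c₀ x)) ∧
      (∀ w : HeightOneSpectrum (𝓞 L), ((3 : ℕ) : 𝓞 L) ∈ w.asIdeal → w ∈ S_L) ∧
      (∀ w : HeightOneSpectrum (𝓞 L), w.under (𝓞 (CyclotomicField 3 ℚ)) ∈ S₀ → w ∈ S_L) ∧
      ∀ k : ℕ, ∃ (P : CuspidalAutomorphicRepData 3 L hcptL)
        (r : FramedGaloisRep L (PadicAlgCl 3) 3),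
        P.1.IsRegularAlgebraic ∧ P.1.IsConjSelfDualAE c ∧
        (∀ w ∉ S_L, P.1.IsUnramifiedAt w ∧ IsGaloisCompatibleAt P.1 ι r w) ∧
        ∀ g : Field.absoluteGaloisGroup L,
          ‖FramedRep.trace r g - FramedRep.trace (ρ.restrictField L) g‖ ≤ ((3 : ℝ)⁻¹) ^ k := by
  sorry

/-- **Stub 5 — THE HEART: two-wall ordinary classicality over `L` (card K1 + K2 + K3(a); hardest).**
For generic `f` (reshape r2: round 1 restricted this stub to `HasMuOrdinaryReductionAtThree f`,
an EMPTY class by Börner–Bouw–Wewers 2017 — module docstring; the intended proof (i)–(iv) below runs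
on the μ-ordinary-JACOBIAN class = BBW type (b), `J(C_f)` potentially good of `3`-rank `2`, a
predicate the tree does not yet have; outside it — λ-basic Jacobian, in particular EVERY `f` whose
curve has potentially good reduction, and the potentially multiplicative types — no ordinary engine
applies and that sub-domain is crux-sized, conceded here pending the planner's re-split), the
twisted Picard representation
`ρ = ρ'_C = ρ_C ⊗ ψ` (pinned by the trace identity of Stub 2 through Chebotarev + Brauer–Nesbitt), and
the field `L = K(√-2)` with its involution `c` (as produced by Stub 4): IF `ρ|_{Γ_L}` is a `3`-adic
limit, in sup-norm of traces on `Γ_L`, of the Galois representations of conjugate-self-dual regular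
algebraic cuspidal `Π_k` on `GL₃(𝔸_L)` of tame level `S_L` (`S_L ⊇` places above `3` and above `S₀`),
THEN `ρ|_{Γ_L}` is automorphic: a cuspidal L-algebraic `π_L` on `GL₃(𝔸_L)` whose Satake parameter `β`
at every `w` outside a finite `S'` has `ρ|_{Γ_L}` unramified at `w` with arithmetic-Frobenius
characteristic polynomial `∏ (X - ι⁻¹(β_j⁻¹))` (`arithFrobPolyOfSatake ι q 1 β`, Buzzard–Gee
normalisation `m = 1`: geometric Frobenius eigenvalues `ι⁻¹ β_j`).  Intended proof, on the unitary
fourfold `𝒮'` of `G' = U(2,1)_{L/L⁺}` at `p = 3` (`G'(ℚ₃) = GL₃(K_λ)`, smooth μ-ordinary-dense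
splitting model of Bijakowski–Hernandez 2022 since `L/L⁺` is split at the unique `v ∣ 3` of
`L⁺ = ℚ(√6)`; contrast the (AR) Picard surface, arXiv:2302.08295 Thm 1.1), which realises exactly the
twisted objects `ρ'_C|_{Γ_L}` (multiplier `ε^{-2}`, weights `{1,1,2} | {0,1,1}` per pair):
(i) REALIZATION (K2): the `Π_k` descend to `G'` (conjugate self-dual, `n` odd: Rogawski/Mok), and
`λ'_{C,L}` becomes a point of the μ-ordinary big Hecke algebra of `𝒮'` at tame level `S_L` with
Galois structure `ρ|_{Γ_L} ⊗ W` on the `λ'_{C,L}`-part of the μ-ordinary higher-Hida `H⁰` of the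
singular weight (typicity via the Eichler–Shimura relation in completed cohomology + BCGP
Prop. ES-semisimple under Zariski closure `⊇ SL₃` — non-CM Picard Jacobian —, triage F3); this needs
an ORDINARY AVATAR of the typed slope-free tower (the `Π_k` μ-ordinary of finite level at `u, ū`),
which the intended towers of 13757 are but the typed interface forgets (Disproof item 7) — second
half of the interface debt, to ride on the same tenure restate as Stub 3, else an
`R^{μ-ord} = T`-type sub-problem shared with 13757; (ii) TWO-WALL ORDINARY SEN = COUSIN (K1,
load-bearing): `p`-adic Eichler–Shimura bi-filtration of `RHom_𝔟(χ, RΓ(𝒮'_{K^p}, ℚ₃)^{la})^{μ-ord}`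
for the Weil-restricted datum `Res_{K_λ/ℚ₃} GL₃`, `μ = ((1,0,0),(1,1,0))`: `Gr^{(0,0′)} = H⁰_{μ-ord}`,
`Gr^{(1,0′)}, Gr^{(0,1′)}` = the two degree-one μ-ordinary higher-Hida groups (incident cells — the
census `{(0,0′),(0,1′),(1,0′),(1,2′),(2,1′),(2,2′)}` checked by triage ×3), the Sen components
`Θ_{σ₁}, Θ_{σ₂}` colliding `(0,0′)` with `(1,0′)` resp. `(0,1′)` and inducing non-zero multiples of
the two Cousin differentials; `ρ|_{G_{L_u}}` de Rham (geometric) ⇒ both Sen operators semisimple ⇒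
the `λ'_{C,L}`-eigenclass lies in the kernel of both Cousin maps ⇒ classical (BCGP 2025 §§1.3–1.4,
§4 with ONE ordinary projector and `e = 2`: their announced "`p` arbitrary in `F`" extension,
arXiv:2502.20645 p. 3); (iii) multiplicity one of `λ'_{C,L}` in the μ-ordinary family (K3(a);
Fourier–Jacobi expansions on `G'` or the `R = T` multiplicity-one output over `L`); (iv) the classical
singular-weight cusp form transfers to a cuspidal `π_L` on `GL₃/L` (Rogawski; Mok 2014), L-algebraic
of the limit-of-discrete-series type, with Hecke polynomials at split AND inert `w` given by the
eigensystem `λ'_{C,L}`, i.e. by `charpoly ρ|_{Γ_L}(Frob_w)`.  TRUE whatever the hypotheses (it is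
implied by reciprocity for `ρ'_C|_{Γ_L}`, like the crux — Disproof item 2); the hypotheses are what
make it PROVABLE along (i)–(iv).  Size XL. -/
theorem stub_twoWallOrdinaryClassicality :
    ∀ (f : ℤ[X]), f.natDegree = 4 → (f.map (Int.castRingHom ℚ)).Separable →
      12 ∣ Nat.card (f.map (Int.castRingHom ℚ)).Gal →
    ∀ (ι : PadicAlgCl 3 ≃+* ℂ) (e : CyclotomicField 3 ℚ →+* ℂ)
      (S₀ : Finset (HeightOneSpectrum (𝓞 (CyclotomicField 3 ℚ))))
      (ϖ : HeightOneSpectrum (𝓞 (CyclotomicField 3 ℚ)) → 𝓞 (CyclotomicField 3 ℚ))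
      (ρ : FramedGaloisRep (CyclotomicField 3 ℚ) (PadicAlgCl 3) 3),
      (∀ v : HeightOneSpectrum (𝓞 (CyclotomicField 3 ℚ)),
        ((3 : ℕ) : 𝓞 (CyclotomicField 3 ℚ)) ∈ v.asIdeal → v ∈ S₀) →
      (∀ 𝔭 ∉ S₀,
        (𝔭.asIdeal = Ideal.span {ϖ 𝔭} ∧
          ϖ 𝔭 - 1 ∈ Ideal.span {(3 : 𝓞 (CyclotomicField 3 ℚ))}) ∧
        ρ.IsUnramifiedAt 𝔭 ∧
        ∀ 𝔓 ∈ 𝔭.primesAbove, ∀ τ : Field.absoluteGaloisGroup (CyclotomicField 3 ℚ),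
          IsArithFrobAt (𝓞 (CyclotomicField 3 ℚ)) τ 𝔓 →
            FramedRep.trace ρ τ⁻¹ = ι.symm (e (↑(picardTrace f 𝔭 * ϖ 𝔭)))) →
    ∀ (L : Type) [Field L] [NumberField L] [Algebra (CyclotomicField 3 ℚ) L]
      (s : L) (c : L ≃ₐ[ℚ] L) (c₀ : CyclotomicField 3 ℚ ≃ₐ[ℚ] CyclotomicField 3 ℚ)
      (hcptL : isCompact_glFiniteIntegralLevel 3 L) (S_L : Finset (HeightOneSpectrum (𝓞 L))),
      NumberField.IsCMField L → c₀ ≠ 1 → s ^ 2 = -2 → Module.finrank (CyclotomicField 3 ℚ) L = 2 →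
      c s = -s →
      (∀ x : CyclotomicField 3 ℚ,
        c (algebraMap (CyclotomicField 3 ℚ) L x) = algebraMap (CyclotomicField 3 ℚ) L (c₀ x)) →
      FramedRep.IsAbsolutelyIrreducible (ρ.restrictField L) →
      (∀ w : HeightOneSpectrum (𝓞 L), ((3 : ℕ) : 𝓞 L) ∈ w.asIdeal → w ∈ S_L) →
      (∀ w : HeightOneSpectrum (𝓞 L), w.under (𝓞 (CyclotomicField 3 ℚ)) ∈ S₀ → w ∈ S_L) →
      (∀ k : ℕ, ∃ (P : CuspidalAutomorphicRepData 3 L hcptL)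
        (r : FramedGaloisRep L (PadicAlgCl 3) 3),
        P.1.IsRegularAlgebraic ∧ P.1.IsConjSelfDualAE c ∧
        (∀ w ∉ S_L, P.1.IsUnramifiedAt w ∧ IsGaloisCompatibleAt P.1 ι r w) ∧
        ∀ g : Field.absoluteGaloisGroup L,
          ‖FramedRep.trace r g - FramedRep.trace (ρ.restrictField L) g‖ ≤ ((3 : ℝ)⁻¹) ^ k) →
    ∃ (πL : CuspidalAutomorphicRepData 3 L hcptL) (S' : Finset (HeightOneSpectrum (𝓞 L))),
      πL.1.IsLAlgebraic ∧
      ∀ w ∉ S', ∃ β : Multiset ℂ, πL.1.HasSatakeParamAt w β ∧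
        (ρ.restrictField L).IsUnramifiedAt w ∧
        (ρ.restrictField L).HasFrobCharpolyAt w (arithFrobPolyOfSatake ι w.residueCard 1 β) := by
  sorry

/-- **Stub 6 — weight-blind quadratic descent `L → K` of the irregular automorphy, and the untwist,
in the crux's SUM form (Arthur–Clozel + Rogawski/Mok + Goldring–Koskivirta; card K3(b)).**  For
generic `f`, the twisted Picard representation `ρ = ρ'_C = ρ_C ⊗ ψ` through `(ι, e)` (primary
generators `ϖ` and the trace identity outside `S₀ ⊇ {v ∣ 3}`), a quadratic CM extension `L/K` on
which `ρ` stays absolutely irreducible, and a cuspidal L-algebraic `π_L` on `GL₃(𝔸_L)` compatible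
with `ρ|_{Γ_L}` outside a finite `S'` (full arithmetic-Frobenius characteristic polynomials, `m = 1`):
there is a cuspidal L-algebraic `π_K` on `GL₃(𝔸_K)` with `Σ Sat(π_K, 𝔭) = e(a_𝔭(f))` for almost
every `𝔭`.  Intended proof: the Satake multisets of `π_L` at `w` and at `σ w` (`σ ∈ Gal(L/K)`) are
both the spectrum of `ρ(Frob_𝔭)`-conjugates, so `IsGaloisStableSatakeAE K π_L` and Arthur–Clozel
III.4.2 (d) (`cuspidal_descent_cyclic`, prime degree `2`, NO regularity needed) gives cuspidal `π₀`
on `GL₃(𝔸_K)` with `BC(π₀) = π_L`, L-algebraic (same archimedean components: every complex place of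
`K` splits in `L`); at SPLIT `𝔭`, `ΣSat(π₀,𝔭) = ι(tr ρ(Frob_𝔭⁻¹)) = e(a_𝔭 ϖ_𝔭)` for `π₀` and
`π₀ ⊗ χ_{L/K}` alike; at INERT `𝔭` only the squares are known, and the sign is pinned GLOBALLY:
`ρ = ρ'_C` is polarized with even multiplier (`ρ^{c₀} ≅ ρ^∨ ε^{-2}`), so `π₀` is essentially
conjugate self-dual and descends (Rogawski, Ann. Math. Stud. 123; Mok 2014; `GU(2,1)` for the
similitude bookkeeping) to the Picard modular surface with the holomorphic limit of discrete series
at `∞` (triage-1's `decide` check of the LDS packet), where Goldring–Koskivirta 2019 (Thm. 3.5.x,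
Hodge type) attach a pseudo-representation `T : Γ_K → ℚ̄_ℓ` with `T(Frob_𝔭) =` Hecke trace of `π₀`
at every good `𝔭`; `T|_{Γ_L}` agrees with `tr ρ'_{C,ℓ}|_{Γ_L}` on degree-one Frobenii (density one),
hence `T = tr(ρ'_{C,ℓ} ⊗ χ^a)` (Taylor: pseudo-representations are traces; Brauer–Nesbitt; Clifford,
`ρ|_{Γ_L}` irreducible), and `π'_K := π₀ ⊗ χ_{L/K}^a` (`exists_twist_quadraticSign`) has
`ΣSat(π'_K,𝔭) = e(a_𝔭(f)·ϖ_𝔭)` at all good `𝔭`; finally UNTWIST: `π_K := π'_K ⊗ ψ_𝔸^{-1}` (twist by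
the inverse of the idelic CM Hecke character, normalised so that the Satake parameters at `𝔭` are
multiplied by `e(ϖ_𝔭)⁻¹` — any norm-power discrepancy is absorbed by a further `|det|^s` twist,
`exists_twist_hasInfinityType`), cuspidal and L-algebraic (`ψ` algebraic of integral type), with
`ΣSat(π_K,𝔭) = e(a_𝔭 f)`.  Risks (card
K3(b)): the central-character bookkeeping producing an honestly `GU(2,1)`-descendable `π₀`, GK's
finite exceptional set, and a `RepData`-model twist-by-Hecke-character fact (tree: `AlgebraicityTwist`,
`exists_twist_quadraticSign`; a general CM twist may have to be vendored).  TRUE under reciprocity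
in any case.  Size L. -/
theorem stub_irregularDescentUntwist :
    ∀ (f : ℤ[X]) (hcpt : isCompact_glFiniteIntegralLevel 3 (CyclotomicField 3 ℚ)),
      f.natDegree = 4 → (f.map (Int.castRingHom ℚ)).Separable →
      12 ∣ Nat.card (f.map (Int.castRingHom ℚ)).Gal →
    ∀ (ι : PadicAlgCl 3 ≃+* ℂ) (e : CyclotomicField 3 ℚ →+* ℂ)
      (S₀ : Finset (HeightOneSpectrum (𝓞 (CyclotomicField 3 ℚ))))
      (ϖ : HeightOneSpectrum (𝓞 (CyclotomicField 3 ℚ)) → 𝓞 (CyclotomicField 3 ℚ))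
      (ρ : FramedGaloisRep (CyclotomicField 3 ℚ) (PadicAlgCl 3) 3),
      (∀ v : HeightOneSpectrum (𝓞 (CyclotomicField 3 ℚ)),
        ((3 : ℕ) : 𝓞 (CyclotomicField 3 ℚ)) ∈ v.asIdeal → v ∈ S₀) →
      (∀ 𝔭 ∉ S₀,
        (𝔭.asIdeal = Ideal.span {ϖ 𝔭} ∧
          ϖ 𝔭 - 1 ∈ Ideal.span {(3 : 𝓞 (CyclotomicField 3 ℚ))}) ∧
        ρ.IsUnramifiedAt 𝔭 ∧
        ∀ 𝔓 ∈ 𝔭.primesAbove, ∀ τ : Field.absoluteGaloisGroup (CyclotomicField 3 ℚ),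
          IsArithFrobAt (𝓞 (CyclotomicField 3 ℚ)) τ 𝔓 →
            FramedRep.trace ρ τ⁻¹ = ι.symm (e (↑(picardTrace f 𝔭 * ϖ 𝔭)))) →
    ∀ (L : Type) [Field L] [NumberField L] [Algebra (CyclotomicField 3 ℚ) L]
      (hcptL : isCompact_glFiniteIntegralLevel 3 L),
      NumberField.IsCMField L → Module.finrank (CyclotomicField 3 ℚ) L = 2 →
      FramedRep.IsAbsolutelyIrreducible (ρ.restrictField L) →
    ∀ (πL : CuspidalAutomorphicRepData 3 L hcptL) (S' : Finset (HeightOneSpectrum (𝓞 L))),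
      πL.1.IsLAlgebraic →
      (∀ w ∉ S', ∃ β : Multiset ℂ, πL.1.HasSatakeParamAt w β ∧
        (ρ.restrictField L).IsUnramifiedAt w ∧
        (ρ.restrictField L).HasFrobCharpolyAt w (arithFrobPolyOfSatake ι w.residueCard 1 β)) →
    ∃ πK : CuspidalAutomorphicRepData 3 (CyclotomicField 3 ℚ) hcpt, πK.1.IsLAlgebraic ∧
      ∀ᶠ 𝔭 : HeightOneSpectrum (𝓞 (CyclotomicField 3 ℚ)) in Filter.cofinite, ∃ α : Multiset ℂ,
        πK.1.HasSatakeParamAt 𝔭 α ∧ α.sum = e (picardTrace f 𝔭) := by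
  sorry

/-! ## The composition: the six stubs imply the crux, by name -/

/-- **The line concludes the crux.**  `IrregularClassicality` for every generic `f` (reshape r2:
no case split — the round-1 split on `HasMuOrdinaryReductionAtThree f` was vacuous, see the module
docstring): unpack the typed tower `(e, 𝔐, S, (P_k))`; `stub_placeOfMaximalIdeal` (LANDED:
`Theorems/PicardMuOrdinaryIrregularClassicalityPlaceOfMaximalIdeal.lean`, p78785; the local copy
is kept until the import is wired in) turns the place `𝔐` into an adapted `ι : ℚ̄₃ ≃ ℂ`;
`stub_twistedPicardGaloisInput` gives the primary generators `ϖ` and `ρ = ρ'_C = ρ_C ⊗ ψ` through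
`(ι, e)` with its trace identity and irreducibility on every quadratic `Γ_L`;
`stub_polarizedTwistedTower` (interface debt) produces the exactly polarized tower for the twisted
traces `e(a_𝔭(f)·ϖ_𝔭)`; `stub_baseChangeToL` produces `L = K(√-2)`, `c`, the level `S_L` and the
Galois-convergent polarized tower over `L`; `stub_twoWallOrdinaryClassicality` (the heart) makes
`ρ|_{Γ_L}` automorphic; `stub_irregularDescentUntwist` descends and untwists to a cuspidal
L-algebraic `π_K` with `ΣSat(π_K,𝔭) = e(a_𝔭(f))` a.e.  Kernel-checked; the only `sorry`s are
inside the stubs. -/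
theorem IrregularClassicality_of :
    Summit.Langlands.Langlands.Theses.PicardMuOrdinary.IrregularClassicality := by
  intro f hcpt hdeg hsep hgal hlim
  classical
  obtain ⟨e, 𝔐, S, h𝔐, h3, htower⟩ := hlim
  -- Stub 1: the place 𝔐 is the place of an isomorphism ι : ℚ̄₃ ≃ ℂ
  obtain ⟨ι, hι⟩ :=
    Summit.Langlands.Langlands.Theorems.IrregularClassicality.SplitRamifiedPrimeSqrt6.stub_placeOfMaximalIdeal
      𝔐 h𝔐 h3
  -- Stub 2: primary generators and the twisted Picard representation through (ι, e)
  obtain ⟨S₀, ϖ, ρ, hS₀, hirr, hρ⟩ := stub_twistedPicardGaloisInput f hdeg hsep hgal ι e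
  -- Stub 3: the interface debt — the exactly polarized tower for the twisted traces
  obtain ⟨c₀, S', hc₀, -, -, hpol⟩ :=
    stub_polarizedTwistedTower f hcpt hdeg hsep hgal e 𝔐 S S₀ ϖ h𝔐 h3
      (fun 𝔭 h𝔭 => (hρ 𝔭 h𝔭).1) htower
  -- Stub 4: base change to L = K(√-2), Galois-convergent polarized tower over L
  obtain ⟨L, _instF, _instNF, _instA, s, c, hcptL, S_L, hCM, hs, hdegL, hcs, hcc₀, hSL3, hSLS₀,
      htowerL⟩ :=
    stub_baseChangeToL 𝔐 h𝔐 h3 ι hι hcpt c₀ hc₀ S' S₀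
      (fun 𝔭 => e (↑(picardTrace f 𝔭 * ϖ 𝔭))) ρ hS₀ (fun 𝔭 h𝔭 => (hρ 𝔭 h𝔭).2) hpol
  -- Stub 5: the heart — ρ|Γ_L is automorphic
  obtain ⟨πL, S'', hLalg, hcompat⟩ :=
    stub_twoWallOrdinaryClassicality f hdeg hsep hgal ι e S₀ ϖ ρ hS₀ hρ L s c c₀ hcptL S_L
      hCM hc₀ hs hdegL hcs hcc₀ (hirr L hdegL) hSL3 hSLS₀ htowerL
  -- Stub 6: descent L → K and untwist, in sum form
  obtain ⟨πK, hKalg, hev⟩ :=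
    stub_irregularDescentUntwist f hcpt hdeg hsep hgal ι e S₀ ϖ ρ hS₀ hρ L hcptL hCM hdegL
      (hirr L hdegL) πL S'' hLalg hcompat
  exact ⟨e, πK, hKalg, hev⟩

end Summit.Langlands.Langlands.Cruxes.IrregularClassicality.SplitRamifiedPrimeSqrt6
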